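import Mathlib
import HarnessLib
import Summits.NavierStokesRegularity.NavierStokesRegularity.Theses.TypeILiouville
import Summits.NavierStokesRegularity.NavierStokesRegularity.Theses.SqueezeCycle
import Literature.Analysis.FluidPDE.LocalTypeI

/-!
# `TypeILiouville.TypeIliouvilleNoTypeII` (stmt-NavierStokesRegularity-0056): the ENERGY split

Crux-strategist split (unit `cstrat-stmt-NavierStokesRegularity-0056-p1`, 2026-08-17) of the shared
crux `NoTypeII` ("every finite-energy blow-up from Schwartz data has the sup-norm Type-I rate") along
the literature's ENERGY notion of Type I (Seregin; Albritton–Barker 2019, arXiv:1811.00502 §1: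
`𝐈(Q) = sup_{Q' ⊂ Q} (A + C + D + E)(Q') < ∞`, in tree `Literature.Analysis.FluidPDE.typeIBound`):

* **S₁ `EnergyTypeISingularPoint`** (crux): every maximal Leray–Hopf classical solution from a rapidly
  decaying datum has, at its blow-up time `T`, a backward singular point `(T, x₀)` carrying a backward
  parabolic ball on which Albritton–Barker's Type-I quantity is finite — NOT every singular point is
  Type II in the energy sense.  Strictly weaker than the crux given finite energy (Type I in time ⇒
  Type I in space: Leslie–Shvydkoy 2018 Thm 1.2, arXiv:1705.04420; `A` bounded ⇒ `𝐈 < ∞`: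
  Albritton–Barker Lemma 2.6), and the literature's native open question (Seregin, arXiv:2606.29468
  p. 3: "It remains unknown whether or not z = 0 is a regular point … Type I if g₀ < ∞, Type II if
  g₀ = ∞").
* **S₂ `NoLocalTypeISingularity`** (crux): no suitable weak solution has a local Type-I singular point
  in Albritton–Barker's sense — VERBATIM the shared item stmt-NavierStokesRegularity-10480 (route
  StretchingWellBinding), `Iff.rfl`-equal to `¬ LocalTypeISingularityExists`; implied by the KNSS
  Liouville conjecture (L) (= item `TypeIliouvilleL`, stmt-10661) through Albritton–Barker's forward
  theorem (`Literature.Analysis.FluidPDE.AlbrittonBarkerForward`) and the tree's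
  `LiouvilleConjectureNS.not_nontrivialMildAncientTypeIExists_measurable`.
* **S₃ `LocalTypeIOfEnergyTypeIPoint`** (support, bookkeeping): a maximal Leray–Hopf classical solution
  with an energy-Type-I backward singular point yields, after the `ν ↦ 1` rescaling and with the
  normalised (Calderón–Zygmund) pressure, a local Type-I singular point (classical ⇒ suitable weak in
  backward balls, `∇u ∈ L²`, `p_CZ ∈ L^{5/3}_loc`, `𝐈` monotone in the ball and insensitive to `p ↦ p + c(t)`).

The composition `S₁ → S₂ → S₃ → NoTypeII` is pure logic and honest about its shape: under S₁ and S₃ a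
maximal solution would exhibit a local Type-I singular point, which S₂ forbids — so NO finite-energy
blow-up from Schwartz data exists (`typeIliouvilleThesis_of_energySplit`) and the rate statement holds
vacuously.  The split therefore does not bound a blow-up rate (four leads, the disprover, two triage
panels and the s1 strategist census agree no such bound is available: Cruxes/TypeIliouvilleNoTypeII/
STRATEGY-CENSUS.md); it DISSOLVES the sup-rate crux into the energy dichotomy, whose Type-II side S₁
is strictly weaker than `NoTypeII` and whose Type-I side S₂ is the conclusion the Liouville programme
of this very route already reaches from (L).  Everything here is sorry-free.
-/

-- the problem directory repeats the summit name (D-0017); core's `dupNamespace` linter fires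
set_option linter.dupNamespace false

noncomputable section

namespace Summit.NavierStokesRegularity.NavierStokesRegularity.Theorems

open Set Filter Topology Function MeasureTheory
open scoped ENNReal
open Literature.Analysis Literature.Analysis.FluidPDE
open Summit.NavierStokesRegularity.NavierStokesRegularity.Theses

/-- **The energy split proves the crux** `TypeILiouville.TypeIliouvilleNoTypeII` (concluded BY NAME):
S₁ (`EnergyTypeISingularPoint`) → S₂ (`NoLocalTypeISingularity`, stmt-10480 verbatim) →
S₃ (`LocalTypeIOfEnergyTypeIPoint`) → `NoTypeII`.  Under S₁ and S₃ a maximal Leray–Hopf solution from a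
rapidly decaying datum produces a local Type-I singular point, contradicting S₂; the Type-I rate then
holds vacuously. [cite: AlbrittonBarker2019, Thm 1.1 and §1 (arXiv:1811.00502)] -/
theorem typeIliouvilleNoTypeII_of_energySplit :
    (∀ (ν T : ℝ), 0 < ν → 0 < T → ∀ (u : ℝ → EuclideanSpace ℝ (Fin 3) → EuclideanSpace ℝ (Fin 3)) (p : ℝ → EuclideanSpace ℝ (Fin 3) → ℝ), Literature.Analysis.FluidPDE.IsMaximalSmoothSolution ν 0 u p T → Literature.Analysis.FluidPDE.IsLerayHopfOn T ν 0 (u 0) u → Literature.Analysis.FluidPDE.HasRapidSpatialDecay (u 0) → ∃ x₀ : EuclideanSpace ℝ (Fin 3), Literature.Analysis.FluidPDE.IsBackwardSingularPoint u (T, x₀) ∧ ∃ r : ℝ, 0 < r ∧ Literature.Analysis.FluidPDE.typeIBound (Literature.Analysis.FluidPDE.parabolicCylinder r (T, x₀)) u p (fun t y => fderiv ℝ (u t) y) < ⊤) →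
    (¬ ∃ (r₀ : ℝ) (z : ℝ × EuclideanSpace ℝ (Fin 3)) (u : ℝ → EuclideanSpace ℝ (Fin 3) → EuclideanSpace ℝ (Fin 3)) (p : ℝ → EuclideanSpace ℝ (Fin 3) → ℝ), Literature.Analysis.FluidPDE.IsLocalTypeISingularPoint r₀ z u p) →
    (∀ (ν T : ℝ), 0 < ν → 0 < T → ∀ (u : ℝ → EuclideanSpace ℝ (Fin 3) → EuclideanSpace ℝ (Fin 3)) (p : ℝ → EuclideanSpace ℝ (Fin 3) → ℝ), Literature.Analysis.FluidPDE.IsMaximalSmoothSolution ν 0 u p T → Literature.Analysis.FluidPDE.IsLerayHopfOn T ν 0 (u 0) u → Literature.Analysis.FluidPDE.HasRapidSpatialDecay (u 0) → (∃ x₀ : EuclideanSpace ℝ (Fin 3), Literature.Analysis.FluidPDE.IsBackwardSingularPoint u (T, x₀) ∧ ∃ r : ℝ, 0 < r ∧ Literature.Analysis.FluidPDE.typeIBound (Literature.Analysis.FluidPDE.parabolicCylinder r (T, x₀)) u p (fun t y => fderiv ℝ (u t) y) < ⊤) → ∃ (r₀ : ℝ) (z : ℝ × EuclideanSpace ℝ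 (Fin 3)) (v : ℝ → EuclideanSpace ℝ (Fin 3) → EuclideanSpace ℝ (Fin 3)) (q : ℝ → EuclideanSpace ℝ (Fin 3) → ℝ), Literature.Analysis.FluidPDE.IsLocalTypeISingularPoint r₀ z v q) →
    Summit.NavierStokesRegularity.NavierStokesRegularity.Theses.TypeILiouville.TypeIliouvilleNoTypeII := by
  intro h₁ h₂ h₃ ν T hν hT u p hmax hLH hdec
  exact absurd (h₃ ν T hν hT u p hmax hLH hdec (h₁ ν T hν hT u p hmax hLH hdec)) h₂

/-- The same split for the verbatim copy `SqueezeCycle.NoTypeII` of the crux (the two decls are the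
same term, `Iff.rfl`; recorded so that either route can be glued by name). [folklore] -/
theorem squeezeCycle_noTypeII_of_energySplit :
    (∀ (ν T : ℝ), 0 < ν → 0 < T → ∀ (u : ℝ → EuclideanSpace ℝ (Fin 3) → EuclideanSpace ℝ (Fin 3)) (p : ℝ → EuclideanSpace ℝ (Fin 3) → ℝ), Literature.Analysis.FluidPDE.IsMaximalSmoothSolution ν 0 u p T → Literature.Analysis.FluidPDE.IsLerayHopfOn T ν 0 (u 0) u → Literature.Analysis.FluidPDE.HasRapidSpatialDecay (u 0) → ∃ x₀ : EuclideanSpace ℝ (Fin 3), Literature.Analysis.FluidPDE.IsBackwardSingularPoint u (T, x₀) ∧ ∃ r : ℝ, 0 < r ∧ Literature.Analysis.FluidPDE.typeIBound (Literature.Analysis.FluidPDE.parabolicCylinder r (T, x₀)) u p (fun t y => fderiv ℝ (u t) y) < ⊤) →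
    (¬ ∃ (r₀ : ℝ) (z : ℝ × EuclideanSpace ℝ (Fin 3)) (u : ℝ → EuclideanSpace ℝ (Fin 3) → EuclideanSpace ℝ (Fin 3)) (p : ℝ → EuclideanSpace ℝ (Fin 3) → ℝ), Literature.Analysis.FluidPDE.IsLocalTypeISingularPoint r₀ z u p) →
    (∀ (ν T : ℝ), 0 < ν → 0 < T → ∀ (u : ℝ → EuclideanSpace ℝ (Fin 3) → EuclideanSpace ℝ (Fin 3)) (p : ℝ → EuclideanSpace ℝ (Fin 3) → ℝ), Literature.Analysis.FluidPDE.IsMaximalSmoothSolution ν 0 u p T → Literature.Analysis.FluidPDE.IsLerayHopfOn T ν 0 (u 0) u → Literature.Analysis.FluidPDE.HasRapidSpatialDecay (u 0) → (∃ x₀ : EuclideanSpace ℝ (Fin 3), Literature.Analysis.FluidPDE.IsBackwardSingularPoint u (T, x₀) ∧ ∃ r : ℝ, 0 < r ∧ Literature.Analysis.FluidPDE.typeIBound (Literature.Analysis.FluidPDE.parabolicCylinder r (T, x₀)) u p (fun t y => fderiv ℝ (u t) y) < ⊤) → ∃ (r₀ : ℝ) (z : ℝ × EuclideanSpace ℝ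 (Fin 3)) (v : ℝ → EuclideanSpace ℝ (Fin 3) → EuclideanSpace ℝ (Fin 3)) (q : ℝ → EuclideanSpace ℝ (Fin 3) → ℝ), Literature.Analysis.FluidPDE.IsLocalTypeISingularPoint r₀ z v q) →
    Summit.NavierStokesRegularity.NavierStokesRegularity.Theses.SqueezeCycle.NoTypeII :=
  typeIliouvilleNoTypeII_of_energySplit

/-- **Honesty clause.**  The three pieces decide the route's THESIS X (`TypeIliouvilleThesis` =
NoBlowup) outright — a non-extendable solution is maximal, S₁ and S₃ make one of its blow-up points a
local Type-I singular point, S₂ forbids it — which is WHY the crux follows vacuously above: the split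
replaces the borrowed sup-rate half of the Type-I/Type-II dichotomy by its energy form (Seregin;
Albritton–Barker 2019 §1), it does not bound a rate. [cite: AlbrittonBarker2019, §1 ("If true, the conjecture excludes Type I singularities")] -/
theorem typeIliouvilleThesis_of_energySplit
    (h₁ : ∀ (ν T : ℝ), 0 < ν → 0 < T → ∀ (u : ℝ → EuclideanSpace ℝ (Fin 3) → EuclideanSpace ℝ (Fin 3)) (p : ℝ → EuclideanSpace ℝ (Fin 3) → ℝ), Literature.Analysis.FluidPDE.IsMaximalSmoothSolution ν 0 u p T → Literature.Analysis.FluidPDE.IsLerayHopfOn T ν 0 (u 0) u → Literature.Analysis.FluidPDE.HasRapidSpatialDecay (u 0) → ∃ x₀ : EuclideanSpace ℝ (Fin 3), Literature.Analysis.FluidPDE.IsBackwardSingularPoint u (T, x₀) ∧ ∃ r : ℝ, 0 < r ∧ Literature.Analysis.FluidPDE.typeIBound (Literature.Analysis.FluidPDE.parabolicCylinder r (T, x₀)) u p (fun t y => fderiv ℝ (u t) y) < ⊤)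
    (h₂ : ¬ ∃ (r₀ : ℝ) (z : ℝ × EuclideanSpace ℝ (Fin 3)) (u : ℝ → EuclideanSpace ℝ (Fin 3) → EuclideanSpace ℝ (Fin 3)) (p : ℝ → EuclideanSpace ℝ (Fin 3) → ℝ), Literature.Analysis.FluidPDE.IsLocalTypeISingularPoint r₀ z u p)
    (h₃ : ∀ (ν T : ℝ), 0 < ν → 0 < T → ∀ (u : ℝ → EuclideanSpace ℝ (Fin 3) → EuclideanSpace ℝ (Fin 3)) (p : ℝ → EuclideanSpace ℝ (Fin 3) → ℝ), Literature.Analysis.FluidPDE.IsMaximalSmoothSolution ν 0 u p T → Literature.Analysis.FluidPDE.IsLerayHopfOn T ν 0 (u 0) u → Literature.Analysis.FluidPDE.HasRapidSpatialDecay (u 0) → (∃ x₀ : EuclideanSpace ℝ (Fin 3), Literature.Analysis.FluidPDE.IsBackwardSingularPoint u (T, x₀) ∧ ∃ r : ℝ, 0 < r ∧ Literature.Analysis.FluidPDE.typeIBound (Literature.Analysis.FluidPDE.parabolicCylinder r (T, x₀)) u p (fun t y => fderiv ℝ (u t) y) < ⊤) → ∃ (r₀ : ℝ) (z : ℝ ×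 EuclideanSpace ℝ (Fin 3)) (v : ℝ → EuclideanSpace ℝ (Fin 3) → EuclideanSpace ℝ (Fin 3)) (q : ℝ → EuclideanSpace ℝ (Fin 3) → ℝ), Literature.Analysis.FluidPDE.IsLocalTypeISingularPoint r₀ z v q) :
    Summit.NavierStokesRegularity.NavierStokesRegularity.Theses.TypeILiouville.TypeIliouvilleThesis := by
  intro ν T hν hT u p hcl hLH hdec
  by_contra hext
  have hmax : IsMaximalSmoothSolution ν 0 u p T := ⟨hcl, hext⟩
  exact h₂ (h₃ ν T hν hT u p hmax hLH hdec (h₁ ν T hν hT u p hmax hLH hdec))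

/-- Conversely the first piece is NECESSARY for the thesis only vacuously, but for the crux it is a
genuine consequence given finite energy (Type I in time ⇒ Type I in space, Leslie–Shvydkoy 2018
Thm 1.2; `A` bounded ⇒ `𝐈 < ∞`, Albritton–Barker Lemma 2.6) — NOT proved here; what IS immediate is
that S₂ and S₃ together make the crux and S₁ EQUIVALENT on the class of maximal solutions, both being
then statements about an empty class. [folklore] -/
theorem energySplit₁_of_thesis
    (hX : Summit.NavierStokesRegularity.NavierStokesRegularity.Theses.TypeILiouville.TypeIliouvilleThesis) :
    ∀ (ν T : ℝ), 0 < ν → 0 < T → ∀ (u : ℝ → EuclideanSpace ℝ (Fin 3) → EuclideanSpace ℝ (Fin 3)) (p : ℝ → EuclideanSpace ℝ (Fin 3) → ℝ), Literature.Analysis.FluidPDE.IsMaximalSmoothSolution ν 0 u p T → Literature.Analysis.FluidPDE.IsLerayHopfOn T ν 0 (u 0) u → Literature.Analysis.FluidPDE.HasRapidSpatialDecay (u 0) → ∃ x₀ : EuclideanSpace ℝ (Fin 3), Literature.Analysis.FluidPDE.IsBackwardSingularPoint u (T, x₀) ∧ ∃ r : ℝ, 0 < r ∧ Literature.Analysis.FluidPDE.typeIBound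 (Literature.Analysis.FluidPDE.parabolicCylinder r (T, x₀)) u p (fun t y => fderiv ℝ (u t) y) < ⊤ :=
  fun ν T hν hT u p hmax hLH hdec => absurd (hX ν T hν hT u p hmax.1 hLH hdec) hmax.2

end Summit.NavierStokesRegularity.NavierStokesRegularity.Theorems

end
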